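import Mathlib
import HarnessLib
import Literature.NumberTheory.DiophantineGeometry.SquarefulSums

/-!
# Sums of three squareful numbers: reduction of Theorem 1 to the conics `C_y`

Browning–Van Valckenborgh 2012 (*Sums of three squareful numbers*, Exp. Math. **21**,
arXiv:1106.4472), formula (1.1): writing each squareful number uniquely as `x²y³` with `y`
square-free,
`N₁(B) = Σ_y μ²(y₀y₁y₂) #{x ∈ ℕ³ ∩ C_y : gcd(x₀y₀, x₁y₁, x₂y₂) = 1, xᵢ²yᵢ³ ≤ B}`
with `C_y : x₀²y₀³ + x₁²y₁³ = x₂²y₂³`. This file proves the half of (1.1) that the lower bound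
(Theorem 1, the named fact `SquarefulSumLowerBound`) needs, and reduces Theorem 1 to a statement
about the individual conics:

* `conicTriples y B` — the set of `x ∈ ℕ³` counted on `C_y` in (1.1) (positive coordinates,
  the coprimality written as `IsABCTriple (x₀²y₀³) (x₁²y₁³) (x₂²y₂³)`, height `x₂²y₂³ ≤ B`);
* `sum_ncard_conicTriples_le` — for any finite set `S` of `y` with square-free coordinates,
  `Σ_{y ∈ S} #conicTriples y B ≤ N₁(B)` (the maps `x ↦ (x₀²y₀³, x₁²y₁³, x₂²y₂³)` are injective
  with pairwise disjoint images inside the set counted by `N₁(B)`: `sq_mul_cube_injective`);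
* `squarefulSumLowerBound_of_conic` — **reduction**: if for every `y` with `μ²(y₀y₁y₂) = 1` and
  every `ε > 0` one has `(π⁻¹ · bvvSummand y - ε) √B ≤ #conicTriples y B` for all large `B`
  (the conic-by-conic form of the Franke–Manin–Tschinkel/Peyre asymptotic that §3 of the paper
  invokes, with the Peyre constant `π⁻¹ · bvvSummand y` of §2.4), then `SquarefulSumLowerBound`.
  Since the Lean statement of Theorem 1 is the `o(1)` form, no uniformity in `y` is needed: for
  each `ε` a finite set of `y` carrying `(1 - ε/2)` of the series `c = π⁻¹ Σ_y bvvSummand y`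
  suffices (and if the series (2.4) were not summable, `c` would be the junk value `0`).

## Not here

The per-conic asymptotic itself (the hypothesis of `squarefulSumLowerBound_of_conic`), which is
the substance of Theorem 1; it is proved in the sibling `…Proofs` files of this directory.
-/

noncomputable section

open Filter Finset

namespace Literature.NumberTheory.DiophantineGeometry

/-! ### The points counted on the conic `C_y` -/

/-- The set of `x = (x₀, x₁, x₂) ∈ ℕ³` counted on the conic `C_y : x₀²y₀³ + x₁²y₁³ = x₂²y₂³` in
formula (1.1) of Browning–Van Valckenborgh 2012: `(x₀²y₀³, x₁²y₁³, x₂²y₂³)` is an abc triple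
(positive, coprime, `x₀²y₀³ + x₁²y₁³ = x₂²y₂³`) of height `x₂²y₂³ ≤ B`. For `x₀²y₀³ + x₁²y₁³ =
x₂²y₂³` the condition `gcd(x₀y₀, x₁y₁, x₂y₂) = 1` of (1.1) is `gcd(x₀²y₀³, x₁²y₁³) = 1`.
[cite: BrowningValckenborgh2012, §1 (1.1)] -/
def conicTriples (y : ℕ × ℕ × ℕ) (B : ℕ) : Set (ℕ × ℕ × ℕ) :=
  {x | IsABCTriple (x.1 ^ 2 * y.1 ^ 3) (x.2.1 ^ 2 * y.2.1 ^ 3) (x.2.2 ^ 2 * y.2.2 ^ 3) ∧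
    x.2.2 ^ 2 * y.2.2 ^ 3 ≤ B}

/-- Unfolding lemma for `conicTriples`. [folklore] -/
theorem mem_conicTriples_iff (y : ℕ × ℕ × ℕ) (B : ℕ) (x : ℕ × ℕ × ℕ) :
    x ∈ conicTriples y B ↔
      IsABCTriple (x.1 ^ 2 * y.1 ^ 3) (x.2.1 ^ 2 * y.2.1 ^ 3) (x.2.2 ^ 2 * y.2.2 ^ 3) ∧
        x.2.2 ^ 2 * y.2.2 ^ 3 ≤ B :=
  Iff.rfl

/-- The sets `conicTriples y B` increase with `B`. [folklore] -/
theorem conicTriples_mono (y : ℕ × ℕ × ℕ) : Monotone (conicTriples y) :=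
  fun _ _ h _ ⟨hx, hB⟩ => ⟨hx, hB.trans h⟩

/-- `x²y³` is squareful (`2`-powerful) for all `x, y`. [folklore] -/
theorem isPowerful_two_sq_mul_cube (x y : ℕ) : IsPowerful 2 (x ^ 2 * y ^ 3) := by
  rw [isPowerful_iff_forall_prime]
  intro p hp hdvd
  rcases hp.dvd_mul.1 hdvd with h | h
  · exact (pow_dvd_pow_of_dvd (hp.dvd_of_dvd_pow h) 2).trans (dvd_mul_right _ _)
  · exact ((pow_dvd_pow_of_dvd (hp.dvd_of_dvd_pow h) 2).trans
      (pow_dvd_pow y (by norm_num : 2 ≤ 3))).trans (dvd_mul_left _ _)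

/-- A positive `x²y³` is at least `x`. [folklore] -/
theorem le_sq_mul_cube {x y : ℕ} (h : 0 < x ^ 2 * y ^ 3) : x ≤ x ^ 2 * y ^ 3 := by
  have hy : 0 < y := by
    rcases Nat.eq_zero_or_pos y with rfl | hy
    · simp at h
    · exact hy
  calc x ≤ x ^ 2 := Nat.le_self_pow two_ne_zero x
    _ ≤ x ^ 2 * y ^ 3 := Nat.le_mul_of_pos_right _ (pow_pos hy 3)

/-- The coordinates of a point of `conicTriples y B` are positive. [folklore] -/
theorem pos_of_mem_conicTriples {y x : ℕ × ℕ × ℕ} {B : ℕ} (hx : x ∈ conicTriples y B) :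
    0 < x.1 ∧ 0 < x.2.1 ∧ 0 < x.2.2 := by
  obtain ⟨⟨h₀, h₁, hsum, -⟩, -⟩ := hx
  have h₂ : 0 < x.2.2 ^ 2 * y.2.2 ^ 3 := hsum ▸ Nat.add_pos_left h₀ _
  refine ⟨Nat.pos_of_ne_zero fun h => ?_, Nat.pos_of_ne_zero fun h => ?_,
    Nat.pos_of_ne_zero fun h => ?_⟩
  · simp [h] at h₀
  · simp [h] at h₁
  · simp [h] at h₂

/-- `conicTriples y B ⊆ [0, B]³`, hence it is finite. [folklore] -/
theorem conicTriples_finite (y : ℕ × ℕ × ℕ) (B : ℕ) : (conicTriples y B).Finite := by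
  refine ((Set.finite_Iic B).prod ((Set.finite_Iic B).prod (Set.finite_Iic B))).subset ?_
  rintro ⟨x₀, x₁, x₂⟩ ⟨⟨h₀, h₁, hsum, -⟩, hB⟩
  simp only [Set.mem_prod, Set.mem_Iic]
  have h₂ : 0 < x₂ ^ 2 * y.2.2 ^ 3 := hsum ▸ Nat.add_pos_left h₀ _
  have hle₀ : x₀ ^ 2 * y.1 ^ 3 ≤ x₂ ^ 2 * y.2.2 ^ 3 := hsum ▸ Nat.le_add_right _ _
  have hle₁ : x₁ ^ 2 * y.2.1 ^ 3 ≤ x₂ ^ 2 * y.2.2 ^ 3 := hsum ▸ Nat.le_add_left _ _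
  exact ⟨(le_sq_mul_cube h₀).trans (hle₀.trans hB), (le_sq_mul_cube h₁).trans (hle₁.trans hB),
    (le_sq_mul_cube h₂).trans hB⟩

/-- The decomposition `n = x²y³` with `y` square-free is unique (for `x > 0`): the primes dividing
`y` are exactly those with odd exponent in `n`. [folklore] -/
theorem sq_mul_cube_injective {x x' y y' : ℕ} (hy : Squarefree y) (hy' : Squarefree y')
    (hx : 0 < x) (hx' : 0 < x') (h : x ^ 2 * y ^ 3 = x' ^ 2 * y' ^ 3) : x = x' ∧ y = y' := by
  have hy0 : y ≠ 0 := hy.ne_zero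
  have hy0' : y' ≠ 0 := hy'.ne_zero
  have hfac : ∀ p : ℕ, 2 * x.factorization p + 3 * y.factorization p =
      2 * x'.factorization p + 3 * y'.factorization p := by
    intro p
    have := congr_arg (fun n => n.factorization p) h
    simpa [Nat.factorization_mul (pow_ne_zero 2 hx.ne') (pow_ne_zero 3 hy0),
      Nat.factorization_mul (pow_ne_zero 2 hx'.ne') (pow_ne_zero 3 hy0'),
      Nat.factorization_pow] using this
  have hyy : y = y' := by
    refine Nat.eq_of_factorization_eq hy0 hy0' fun p => ?_
    have h1 := hy.natFactorization_le_one p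
    have h2 := hy'.natFactorization_le_one p
    have h3 := hfac p
    omega
  subst hyy
  refine ⟨?_, rfl⟩
  have hsq : x ^ 2 = x' ^ 2 := Nat.eq_of_mul_eq_mul_right (pow_pos (Nat.pos_of_ne_zero hy0) 3) h
  exact Nat.pow_left_injective two_ne_zero hsq

/-- For `x ∈ conicTriples y B` the triple `(x₀²y₀³, x₁²y₁³, x₂²y₂³)` is counted by `N₁(B)`.
[cite: BrowningValckenborgh2012, §1 (1.1)] -/
theorem sq_mul_cube_mem_squarefulSumTriples {y x : ℕ × ℕ × ℕ} {B : ℕ}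
    (hx : x ∈ conicTriples y B) :
    (x.1 ^ 2 * y.1 ^ 3, x.2.1 ^ 2 * y.2.1 ^ 3, x.2.2 ^ 2 * y.2.2 ^ 3) ∈ squarefulSumTriples B :=
  (mem_squarefulSumTriples_iff B _).2 ⟨hx.1, hx.2, isPowerful_two_sq_mul_cube _ _,
    isPowerful_two_sq_mul_cube _ _, isPowerful_two_sq_mul_cube _ _⟩

/-- **Half of formula (1.1) of Browning–Van Valckenborgh 2012.** For a finite set `S` of `y ∈ ℕ³`
with square-free coordinates, `Σ_{y ∈ S} #conicTriples y B ≤ N₁(B)`: the maps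
`x ↦ (x₀²y₀³, x₁²y₁³, x₂²y₂³)` send `conicTriples y B` injectively onto pairwise disjoint subsets
of the set counted by `N₁(B)`. (With `S` = all `y` with `μ²(y₀y₁y₂) = 1` this is an equality,
which is not needed here.) [cite: BrowningValckenborgh2012, §1 (1.1)] -/
theorem sum_ncard_conicTriples_le (S : Finset (ℕ × ℕ × ℕ))
    (hS : ∀ y ∈ S, Squarefree y.1 ∧ Squarefree y.2.1 ∧ Squarefree y.2.2) (B : ℕ) :
    ∑ y ∈ S, (conicTriples y B).ncard ≤ squarefulSumCount B := by
  classical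
  set Φ : (ℕ × ℕ × ℕ) → (ℕ × ℕ × ℕ) → ℕ × ℕ × ℕ := fun y x =>
    (x.1 ^ 2 * y.1 ^ 3, x.2.1 ^ 2 * y.2.1 ^ 3, x.2.2 ^ 2 * y.2.2 ^ 3) with hΦ
  set A : (ℕ × ℕ × ℕ) → Finset (ℕ × ℕ × ℕ) := fun y =>
    ((conicTriples_finite y B).toFinset).image (Φ y) with hA
  have hinj : ∀ y ∈ S, Set.InjOn (Φ y) (conicTriples y B) := by
    intro y hy x hx x' hx' hxx
    obtain ⟨h1, h2, h3⟩ := hS y hy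
    simp only [hΦ, Prod.mk.injEq] at hxx
    obtain ⟨e0, e1, e2⟩ := hxx
    obtain ⟨p0, p1, p2⟩ := pos_of_mem_conicTriples hx
    obtain ⟨p0', p1', p2'⟩ := pos_of_mem_conicTriples hx'
    exact Prod.ext (sq_mul_cube_injective h1 h1 p0 p0' e0).1
      (Prod.ext (sq_mul_cube_injective h2 h2 p1 p1' e1).1
        (sq_mul_cube_injective h3 h3 p2 p2' e2).1)
  have hcard : ∀ y ∈ S, (A y).card = (conicTriples y B).ncard := by
    intro y hy
    rw [hA, Finset.card_image_of_injOn (by simpa using hinj y hy),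
      Set.ncard_eq_toFinset_card _ (conicTriples_finite y B)]
  have hdisj : (S : Set (ℕ × ℕ × ℕ)).PairwiseDisjoint A := by
    intro y hy y' hy' hne
    rw [Function.onFun, Finset.disjoint_left]
    intro t ht ht'
    simp only [hA, Finset.mem_image, Set.Finite.mem_toFinset] at ht ht'
    obtain ⟨x, hx, rfl⟩ := ht
    obtain ⟨x', hx', hxx⟩ := ht'
    obtain ⟨h1, h2, h3⟩ := hS y hy
    obtain ⟨h1', h2', h3'⟩ := hS y' hy'
    simp only [hΦ, Prod.mk.injEq] at hxx
    obtain ⟨e0, e1, e2⟩ := hxx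
    obtain ⟨p0, p1, p2⟩ := pos_of_mem_conicTriples hx
    obtain ⟨p0', p1', p2'⟩ := pos_of_mem_conicTriples hx'
    exact hne (Prod.ext (sq_mul_cube_injective h1' h1 p0' p0 e0).2
      (Prod.ext (sq_mul_cube_injective h2' h2 p1' p1 e1).2
        (sq_mul_cube_injective h3' h3 p2' p2 e2).2)).symm
  have hsub : S.biUnion A ⊆ (squarefulSumTriples_finite B).toFinset := by
    intro t ht
    simp only [Finset.mem_biUnion, hA, Finset.mem_image, Set.Finite.mem_toFinset] at ht ⊢
    obtain ⟨y, -, x, hx, rfl⟩ := ht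
    exact sq_mul_cube_mem_squarefulSumTriples hx
  calc ∑ y ∈ S, (conicTriples y B).ncard = ∑ y ∈ S, (A y).card :=
        Finset.sum_congr rfl fun y hy => (hcard y hy).symm
    _ = (S.biUnion A).card := (Finset.card_biUnion hdisj).symm
    _ ≤ (squarefulSumTriples_finite B).toFinset.card := Finset.card_le_card hsub
    _ = squarefulSumCount B := (Set.ncard_eq_toFinset_card _ (squarefulSumTriples_finite B)).symm

/-- `bvvSummand y = 0` unless `y₀y₁y₂` is square-free. [folklore] -/
theorem bvvSummand_of_not_squarefree {y : ℕ × ℕ × ℕ} (h : ¬Squarefree (y.1 * y.2.1 * y.2.2)) :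
    bvvSummand y = 0 := by
  simp [bvvSummand, h]

/-! ### The reduction -/

/-- **Reduction of Theorem 1 of Browning–Van Valckenborgh 2012 to the conics `C_y`.** If for every
`y` with `μ²(y₀y₁y₂) = 1` the points of `conicTriples y B` number at least
`(π⁻¹ · bvvSummand y - ε) √B` for all large `B` (every `ε > 0`) — i.e. the per-conic asymptotic
lower bound with Peyre's constant `c_{H_y}(C_y(𝔸_ℚ)⁺)/4 = π⁻¹ · bvvSummand y` (§§2.4, 3 of the
paper) — then `N₁(B) ≥ (1 - ε) c √B` for all large `B`, every `ε > 0` (`SquarefulSumLowerBound`).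
Proof: `c = π⁻¹ Σ_y bvvSummand y` is a series of nonnegative terms; if it is not summable then
`c = 0` in Lean and there is nothing to prove, otherwise a finite set of `y` carries `(1 - ε/2)`
of its sum, and `sum_ncard_conicTriples_le` adds up the finitely many conic bounds.
[cite: BrowningValckenborgh2012, §3] -/
theorem squarefulSumLowerBound_of_conic
    (h : ∀ y : ℕ × ℕ × ℕ, Squarefree (y.1 * y.2.1 * y.2.2) → ∀ ε : ℝ, 0 < ε →
      ∀ᶠ B : ℕ in atTop,
        (Real.pi⁻¹ * bvvSummand y - ε) * Real.sqrt B ≤ ((conicTriples y B).ncard : ℝ)) :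
    SquarefulSumLowerBound := by
  classical
  intro ε hε
  by_cases hsum : Summable bvvSummand
  swap
  · rw [squarefulSumConstant, tsum_eq_zero_of_not_summable hsum]
    exact Eventually.of_forall fun B => by simp
  set s : ℝ := ∑' y, bvvSummand y with hs
  have hs0 : 0 ≤ s := tsum_nonneg bvvSummand_nonneg
  rcases hs0.eq_or_lt with hs00 | hspos
  · rw [squarefulSumConstant, ← hs, ← hs00]
    exact Eventually.of_forall fun B => by simp
  -- a finite set of `y` carrying `(1 - ε/2)` of the series
  have hHas : HasSum bvvSummand s := hsum.hasSum
  obtain ⟨S₀, hS₀⟩ : ∃ S₀ : Finset (ℕ × ℕ × ℕ), s - ε / 2 * s < ∑ y ∈ S₀, bvvSummand y :=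
    (hHas.eventually (Ioi_mem_nhds (by nlinarith : s - ε / 2 * s < s))).exists
  set S := S₀.filter fun y => Squarefree (y.1 * y.2.1 * y.2.2) with hSdef
  have hSsum : ∑ y ∈ S, bvvSummand y = ∑ y ∈ S₀, bvvSummand y := by
    rw [hSdef, Finset.sum_filter]
    refine Finset.sum_congr rfl fun y _ => ?_
    split_ifs with hy
    · rfl
    · exact (bvvSummand_of_not_squarefree hy).symm
  have hSsq : ∀ y ∈ S, Squarefree (y.1 * y.2.1 * y.2.2) := fun y hy => (Finset.mem_filter.1 hy).2
  -- the per-conic bounds, with `ε' = ε c / (2 (#S + 1))`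
  set c : ℝ := Real.pi⁻¹ * s with hc
  have hcpos : 0 < c := mul_pos (inv_pos.2 Real.pi_pos) hspos
  set ε' : ℝ := ε * c / (2 * (S.card + 1)) with hε'
  have hε'pos : 0 < ε' := by positivity
  have hev : ∀ᶠ B : ℕ in atTop, ∀ y ∈ S,
      (Real.pi⁻¹ * bvvSummand y - ε') * Real.sqrt B ≤ ((conicTriples y B).ncard : ℝ) :=
    (S.eventually_all).2 fun y hy => h y (hSsq y hy) ε' hε'pos
  filter_upwards [hev] with B hB
  have hle : ∑ y ∈ S, (conicTriples y B).ncard ≤ squarefulSumCount B :=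
    sum_ncard_conicTriples_le S (fun y hy =>
      ⟨Squarefree.of_mul_left (Squarefree.of_mul_left (hSsq y hy)),
        Squarefree.of_mul_right (Squarefree.of_mul_left (hSsq y hy)),
        Squarefree.of_mul_right (hSsq y hy)⟩) B
  have hle' : (∑ y ∈ S, ((conicTriples y B).ncard : ℝ)) ≤ (squarefulSumCount B : ℝ) := by
    exact_mod_cast hle
  have hsumB : ∑ y ∈ S, (Real.pi⁻¹ * bvvSummand y - ε') * Real.sqrt B ≤
      ∑ y ∈ S, ((conicTriples y B).ncard : ℝ) := Finset.sum_le_sum hB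
  have hkey : (1 - ε) * c ≤ ∑ y ∈ S, (Real.pi⁻¹ * bvvSummand y - ε') := by
    rw [Finset.sum_sub_distrib, Finset.sum_const, nsmul_eq_mul, ← Finset.mul_sum, hSsum]
    have h1 : (S.card : ℝ) * ε' ≤ ε * c / 2 := by
      rw [hε']
      have hk : (0 : ℝ) ≤ S.card := Nat.cast_nonneg _
      rw [mul_div_assoc']
      rw [div_le_div_iff₀ (by positivity) (by positivity)]
      nlinarith [hcpos, hε]
    have h2 : Real.pi⁻¹ * (s - ε / 2 * s) ≤ Real.pi⁻¹ * ∑ y ∈ S₀, bvvSummand y :=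
      mul_le_mul_of_nonneg_left hS₀.le (inv_pos.2 Real.pi_pos).le
    have h3 : Real.pi⁻¹ * (s - ε / 2 * s) = (1 - ε / 2) * c := by rw [hc]; ring
    linarith
  have hsq : 0 ≤ Real.sqrt B := Real.sqrt_nonneg _
  calc (1 - ε) * squarefulSumConstant * Real.sqrt B = (1 - ε) * c * Real.sqrt B := by
        rw [squarefulSumConstant, hc]
    _ ≤ (∑ y ∈ S, (Real.pi⁻¹ * bvvSummand y - ε')) * Real.sqrt B :=
        mul_le_mul_of_nonneg_right hkey hsq
    _ = ∑ y ∈ S, (Real.pi⁻¹ * bvvSummand y - ε') * Real.sqrt B := Finset.sum_mul _ _ _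
    _ ≤ ∑ y ∈ S, ((conicTriples y B).ncard : ℝ) := hsumB
    _ ≤ squarefulSumCount B := hle'

end Literature.NumberTheory.DiophantineGeometry
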